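import Summits.NavierStokesRegularity.NavierStokesRegularity.Theses.AxisymmetricExtremality
import Summits.NavierStokesRegularity.NavierStokesRegularity.Theorems.AxisymmetricExtremalityAxisymmetricKatoGlobalStubSereginLogSwirlOriginHmidiRousset
import Literature.Analysis.FluidPDE.HouLeiLiEstimate
import Literature.Analysis.FluidPDE.AxisymGradientField
import Literature.Analysis.FluidPDE.HessianLaplacian
import Literature.Analysis.FluidPDE.VorticityCalculus
import HarnessLib

/-!
# Global `L²` bounds `‖∇(u_r/r)‖₂ ≤ ‖ω_θ/r‖₂`, `‖∇²(u_r/r)‖₂ ≤ ‖∂₃(ω_θ/r)‖₂` for compactly supported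
# axisymmetric divergence-free fields (Chen–Fang–Zhang 2017, Lemma 2.3; Miao–Zheng 2013,
# Prop. 2.5; Lei–Zhang 2017, Lemma 2.1) — crux stmt-NavierStokesRegularity-15453
# (`AxisymmetricExtremality.AxisymmetricKatoGlobal`), line registered, support for stub
# `stub_sereginLogSwirlOrigin`

Support file (`--supports stmt-NavierStokesRegularity-15453`; theorems only, everything proved)
toward the registered stub `stub_sereginLogSwirlOrigin` = the named fact
`Literature.Analysis.FluidPDE.seregin2022_logSwirl_regularAtOrigin` (G. Seregin, J. Math. Fluid
Mech. 24 (2022), Paper 27 = arXiv:2201.00153, §2). Step 2 there is Lemma 2.1, the localised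
div–curl estimates `‖∇(η³v_r/r)‖₂ ≤ c‖η³Γ‖₂ + C(v,η)`, `‖∇̄²(η³v_r/r)‖₂ ≤ c‖η³Γ,₃‖₂ + C(v,η)`
(`Γ = ω_θ/r`), whose global core is quoted from Chen–Fang–Zhang 2017 (Lemma 2.3; also Miao–Zheng
2013, Prop. 2.5, Hou–Lei–Li 2008, Lei–Zhang 2017, Lemma 2.1): for the function
`W = −(1/r) e_r · Δ⁻¹((ζω_θ),₃ e_r)`, i.e. `W = u_r/r` of the axisymmetric swirl-free
divergence-free field `u` with vorticity `ζω_θ e_θ`,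
"`‖∇W‖_{2,ℝ³} ≤ c‖ζΓ‖_{2,ℝ³}`, `‖∇̄²W‖_{2,ℝ³} ≤ c‖(ζΓ),₃‖_{2,ℝ³}`" (arXiv p. 5).

This file proves these two GLOBAL bounds, with the absolute constant `c = 1` and the full
Cartesian Hessian, for every axisymmetric divergence-free vector field `u : ℝ³ → ℝ³` of class `C⁴`
(first bound) / `C⁵` (second bound) with compact support, in the tree's smooth Hou–Li variables
`radVelQuot u = u_r/r`, `angVortQuot u = ω_θ/r` (`AxisymHouLiVariables`; no swirl-freeness is
needed — the swirl component enters neither `u_r/r` nor `ω_θ`):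

* `integral_gradSq_radVelQuot_le_of_hasCompactSupport` — `∫ Σᵢ (∂ᵢ(u_r/r))² ≤ ∫ (ω_θ/r)²`;
* `eLpNorm_fderiv_radVelQuot_le_eLpNorm_angVortQuot` (registered sub-goal) — for every direction
  `a`, `‖a‖ ≤ 1`: `‖∂ₐ(u_r/r)‖_{L²(ℝ³)} ≤ ‖ω_θ/r‖_{L²(ℝ³)}`;
* `integral_hessianSq_radVelQuot_le_of_hasCompactSupport` — `∫ Σᵢⱼ (∂ⱼ∂ᵢ(u_r/r))² ≤ ∫ (∂₃(ω_θ/r))²`;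
* `eLpNorm_fderiv_fderiv_radVelQuot_le_eLpNorm_fderiv_angVortQuot` (registered sub-goal) — for
  all directions `a, b` of norm `≤ 1`: `‖∂_b∂ₐ(u_r/r)‖_{L²(ℝ³)} ≤ ‖∂₃(ω_θ/r)‖_{L²(ℝ³)}`.

Proof route (the `L²`/Plancherel content of the printed Calderón–Zygmund step is the
Hessian–Laplacian identity; no Biot–Savart law is needed): the tree proves Lei–Zhang's Lemma 2.1
from the 5D-Laplacian identity `Δ(u_r/r) + (2/r)∂ᵣ(u_r/r) = ∂₃(ω_θ/r)`
(`IsAxisymmetric.laplacian_radVelQuot_add`) by two integrations by parts, as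
`IsAxisymmetric.integral_gradSq_radVelQuot_le` (`∫|∇ρ|² ≤ ∫Γ²`) and
`IsAxisymmetric.integral_laplacian_radVelQuot_sq_le'` (`∫(Δρ)² ≤ ∫(∂₃Γ)²`), each under a dozen
explicit `L²` provisos on `ρ = u_r/r`, `Γ` and their derivatives, and
`integral_sum_sq_fderiv_fderiv_eq_integral_laplacian_sq_of_memLp` gives `∫|∇²ρ|² = ∫(Δρ)²`. Here
the provisos are discharged for compactly supported fields: the smooth quotients `radQuot S`,
`radDerivQuot S` of a compactly supported axisymmetric scalar `S` (vanishing on the axis, for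
`radQuot`) are compactly supported (off `{x₀ = 0}` they are `S/r²`, `∂₀S/x₀`, and a continuous
function vanishing on `U ∖ {x₀ = 0}`, `U` open, vanishes on `U`), hence so are `u_r/r`, `ω_θ/r`
and their derivatives, and continuous compactly supported functions are in `L²`; the directional
forms use the pointwise Cauchy–Schwarz bounds `(∂ₐρ)² ≤ ‖a‖²Σᵢ(∂ᵢρ)²` (`sq_fderiv_apply_le`),
`(∂_b∂ₐρ)² ≤ ‖a‖²‖b‖² Σᵢⱼ(∂ⱼ∂ᵢρ)²` (`sq_fderiv_fderiv_apply_le_normSq_mul_sum`).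

What remains of Lemma 2.1 after this file and the Hmidi–Rousset identity
(`hmidiRousset_identity`): the localisation bookkeeping for `ζv̄` (`ζ = η³`), which is compactly
supported but not divergence-free (`div(ζv̄) = v̄·∇ζ`); for it the identity above acquires the
source `(1/r)∂ᵣ(div u)` (`Δρ + 2q_ρ = ∂₃Γ + radDerivQuot (div u)`), whose contribution is the
printed `C(v,η)`.

## Mathlib / tree search

Tree inputs: `IsAxisymmetric.integral_gradSq_radVelQuot_le`,
`IsAxisymmetric.integral_laplacian_radVelQuot_sq_le'` (`HouLeiLiEstimate`, `AxisymGradientField`),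
`integral_sum_sq_fderiv_fderiv_eq_integral_laplacian_sq_of_memLp`, `sq_fderiv_apply_le`,
`fderiv_fderiv_apply_comm_vec_scalar`, `continuous/hasCompactSupport_fderiv_fderiv_apply`
(`HessianLaplacian`), `radQuot_eq_div`, `mul_radDerivQuot_eq_fderiv_zero` (`AxisymRadialQuotient`),
`hasCompactSupport_curl` (`VorticityCalculus`), `IsAxisymmetricScalar.fderiv_apply_single_two`.
Mathlib: `Continuous.memLp_of_hasCompactSupport`, `HasCompactSupport.mono'`,
`HasCompactSupport.fderiv_apply`, `fderiv_of_notMem_tsupport`, `MemLp.eLpNorm_eq_integral_rpow_norm`.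
`lean search 'hasCompactSupport_radQuot|hasCompactSupport_radVelQuot|eLpNorm_fderiv_radVelQuot|ChenFangZhang|MiaoZheng'`:
no matches (2026-08-17); the `H^∞` provisos (all Sobolev norms finite) are discharged in
`HouLiVariablesMemLp` (`IsAxisymmetric.abs_radVelQuot_le_of_sobolev`), not the compact-support ones.

## References

* G. Seregin, J. Math. Fluid Mech. 24 (2022), Paper No. 27 = arXiv:2201.00153, §2, Lemma 2.1
  (arXiv p. 5: "As to the function `W`, the global estimates have been already established in
  [ChenFangZhang2017]"). [`Seregin2022LocalAxisym`]
* H. Chen, D. Fang, T. Zhang, Discrete Contin. Dyn. Syst. 37 (2017) 1923–1939, Lemma 2.3;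
  C. Miao, X. Zheng, Comm. Math. Phys. 321 (2013) 33–67, Prop. 2.5. [`ChenFangZhang2017`]
* Z. Lei, Q. S. Zhang, Pacific J. Math. 289 (2017) 169–187 = arXiv:1505.02628, Lemma 2.1.
  [`LeiZhang2017`]
-/

noncomputable section

open MeasureTheory Set Filter Topology Function
open scoped ENNReal ContDiff Laplacian
open Literature.Analysis.FluidPDE

-- `<Problem> = <Summit>` duplicates a namespace component by design (lakefile sets the same option).
set_option linter.dupNamespace false

namespace Summit.NavierStokesRegularity.NavierStokesRegularity.Theorems.AxisymmetricKatoGlobal.EulerScaling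

/-! ### Compact support of the smooth radial quotients -/

section Support

variable {S : EuclideanSpace ℝ (Fin 3) → ℝ}

/-- **Local density off the hyperplane `{x₀ = 0}`.** A continuous `g` which vanishes at the
points `z` of an open set `U` with `z₀ ≠ 0` vanishes on all of `U` (approach `y ∈ U` along
`t ↦ y + t e₀`, `t ≠ 0`). [folklore] -/
theorem eq_zero_of_forall_apply_zero_ne {g : EuclideanSpace ℝ (Fin 3) → ℝ} (hg : Continuous g)
    {U : Set (EuclideanSpace ℝ (Fin 3))} (hU : IsOpen U)
    (h : ∀ z ∈ U, z 0 ≠ 0 → g z = 0) {y : EuclideanSpace ℝ (Fin 3)} (hy : y ∈ U) : g y = 0 := by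
  by_cases hy0 : y 0 ≠ 0
  · exact h y hy hy0
  push Not at hy0
  have htend : Tendsto (fun t : ℝ => y + t • (EuclideanSpace.single 0 1 : EuclideanSpace ℝ (Fin 3)))
      (𝓝[≠] 0) (𝓝 y) := by
    have hc : Continuous fun t : ℝ =>
        y + t • (EuclideanSpace.single 0 1 : EuclideanSpace ℝ (Fin 3)) := by fun_prop
    have := hc.tendsto 0
    rw [zero_smul, add_zero] at this
    exact this.mono_left nhdsWithin_le_nhds
  have hU' : ∀ᶠ t : ℝ in 𝓝[≠] 0,
      y + t • (EuclideanSpace.single 0 1 : EuclideanSpace ℝ (Fin 3)) ∈ U :=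
    htend (hU.mem_nhds hy)
  have hev : (fun t : ℝ => g (y + t • (EuclideanSpace.single 0 1 : EuclideanSpace ℝ (Fin 3))))
      =ᶠ[𝓝[≠] 0] fun _ => (0 : ℝ) := by
    filter_upwards [hU', self_mem_nhdsWithin] with t ht ht0
    refine h _ ht ?_
    simpa [hy0] using ht0
  exact tendsto_nhds_unique_of_eventuallyEq ((hg.tendsto y).comp htend) tendsto_const_nhds hev

/-- **`(∂ᵣS)/r` vanishes off the support of `S`**: for an axisymmetric scalar `S ∈ C²` and
`y ∉ tsupport S`, `radDerivQuot S y = 0` (off `{x₀ = 0}` it is `∂₀S/x₀`, `∂₀S = 0` off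
`tsupport S`, and density). [folklore] -/
theorem radDerivQuot_eq_zero_of_notMem_tsupport (hS : ContDiff ℝ 2 S) (hax : IsAxisymmetricScalar S)
    {y : EuclideanSpace ℝ (Fin 3)} (hy : y ∉ tsupport S) : radDerivQuot S y = 0 := by
  refine eq_zero_of_forall_apply_zero_ne (continuous_radDerivQuot hS)
    (isClosed_tsupport S).isOpen_compl (fun z hz hz0 => ?_) hy
  have h := mul_radDerivQuot_eq_fderiv_zero hS hax z
  rw [fderiv_of_notMem_tsupport ℝ hz] at h
  simpa [hz0] using h

/-- **The radial derivative quotient of a compactly supported axisymmetric scalar `S ∈ C²` is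
compactly supported** (`support ⊆ tsupport S`). [folklore] -/
theorem hasCompactSupport_radDerivQuot (hS : ContDiff ℝ 2 S) (hax : IsAxisymmetricScalar S)
    (hc : HasCompactSupport S) : HasCompactSupport (radDerivQuot S) :=
  hc.mono' fun _ hy => by_contra fun h => hy (radDerivQuot_eq_zero_of_notMem_tsupport hS hax h)

/-- **`S/r²` vanishes off the support of `S`**: for an axisymmetric scalar `S ∈ C²` vanishing on
the axis and `y ∉ tsupport S`, `radQuot S y = 0` (off `{x₀ = 0}` it is `S/r²`, and density).
[folklore] -/
theorem radQuot_eq_zero_of_notMem_tsupport (hS : ContDiff ℝ 2 S) (hax : IsAxisymmetricScalar S)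
    (h0 : ∀ y, cylRadius y = 0 → S y = 0) {y : EuclideanSpace ℝ (Fin 3)} (hy : y ∉ tsupport S) :
    radQuot S y = 0 := by
  refine eq_zero_of_forall_apply_zero_ne (continuous_radQuot hS)
    (isClosed_tsupport S).isOpen_compl (fun z hz hz0 => ?_) hy
  have hr : cylRadius z ≠ 0 := fun h => hz0 ((cylRadius_eq_zero_iff z).1 h).1
  rw [radQuot_eq_div hS hax h0 hr, image_eq_zero_of_notMem_tsupport hz, zero_div]

/-- **The radial quotient of a compactly supported axisymmetric scalar `S ∈ C²` vanishing on the
axis is compactly supported** (`support ⊆ tsupport S`). [folklore] -/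
theorem hasCompactSupport_radQuot (hS : ContDiff ℝ 2 S) (hax : IsAxisymmetricScalar S)
    (h0 : ∀ y, cylRadius y = 0 → S y = 0) (hc : HasCompactSupport S) :
    HasCompactSupport (radQuot S) :=
  hc.mono' fun _ hy => by_contra fun h => hy (radQuot_eq_zero_of_notMem_tsupport hS hax h0 h)

variable {u : EuclideanSpace ℝ (Fin 3) → EuclideanSpace ℝ (Fin 3)}

/-- **`u_r/r` of a compactly supported axisymmetric `u ∈ C²` is compactly supported.** [folklore] -/
theorem hasCompactSupport_radVelQuot (hu : ContDiff ℝ 2 u) (hax : IsAxisymmetric u)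
    (hc : HasCompactSupport u) : HasCompactSupport (radVelQuot u) := by
  have hcS : HasCompactSupport fun x : EuclideanSpace ℝ (Fin 3) => x 0 * u x 0 + x 1 * u x 1 := by
    refine hc.mono fun x hx => ?_
    rw [mem_support] at hx ⊢
    contrapose! hx
    simp [hx]
  unfold radVelQuot
  exact hasCompactSupport_radQuot (contDiff_horizontal_inner hu)
    hax.isAxisymmetricScalar_horizontal_inner
    (fun y hy => by
      obtain ⟨hy0, hy1⟩ := (cylRadius_eq_zero_iff y).1 hy
      simp [hy0, hy1]) hcS

/-- **`ω_θ/r` of a compactly supported axisymmetric `u ∈ C³` is compactly supported.** [folklore] -/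
theorem hasCompactSupport_angVortQuot (hu : ContDiff ℝ 3 u) (hax : IsAxisymmetric u)
    (hc : HasCompactSupport u) : HasCompactSupport (angVortQuot u) := by
  have hcurl : HasCompactSupport (Literature.Analysis.FluidPDE.curl u) := hasCompactSupport_curl hc
  have hcS : HasCompactSupport (swirl (Literature.Analysis.FluidPDE.curl u)) := by
    refine hcurl.mono fun x hx => ?_
    rw [mem_support] at hx ⊢
    contrapose! hx
    simp [swirl, hx]
  unfold angVortQuot
  exact hasCompactSupport_radQuot
    (contDiff_swirl (contDiff_curl (n := 2) (by exact_mod_cast hu)))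
    (hax.isAxisymmetricScalar_swirl_curl (hu.differentiable (by norm_num)))
    (fun y hy => swirl_eq_zero_of_cylRadius_eq_zero _ hy) hcS

end Support

/-! ### `L²` bookkeeping -/

section LTwo

variable {f g : EuclideanSpace ℝ (Fin 3) → ℝ}

/-- `∂ₐf ∈ L²` for a compactly supported `f ∈ C¹`. [folklore] -/
theorem memLp_fderiv_apply_of_hasCompactSupport (hf : ContDiff ℝ 1 f) (hc : HasCompactSupport f)
    (a : EuclideanSpace ℝ (Fin 3)) : MemLp (fun x => fderiv ℝ f x a) 2 volume :=
  ((hf.continuous_fderiv one_ne_zero).clm_apply continuous_const).memLp_of_hasCompactSupport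
    (hc.fderiv_apply ℝ a)

/-- `∂_b∂ₐf ∈ L²` for a compactly supported `f ∈ C²`. [folklore] -/
theorem memLp_fderiv_fderiv_apply_of_hasCompactSupport (hf : ContDiff ℝ 2 f)
    (hc : HasCompactSupport f) (a b : EuclideanSpace ℝ (Fin 3)) :
    MemLp (fun x => fderiv ℝ (fun y => fderiv ℝ f y a) x b) 2 volume :=
  (continuous_fderiv_fderiv_apply hf a b).memLp_of_hasCompactSupport
    (hasCompactSupport_fderiv_fderiv_apply hc a b)

/-- Comparison of `L²` norms from a comparison of `∫ f²`: for `f, g ∈ L²(ℝ³)` real-valued,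
`∫ f² ≤ ∫ g² ⇒ ‖f‖_{L²} ≤ ‖g‖_{L²}` (cf. `RieszHeat.eLpNorm_two_le_of_integral_sq_le`, outside
this import cone). [folklore] -/
private theorem eLpNorm_two_le_of_integral_sq_le' (hf : MemLp f 2 volume) (hg : MemLp g 2 volume)
    (h : ∫ x, f x ^ 2 ≤ ∫ x, g x ^ 2) : eLpNorm f 2 volume ≤ eLpNorm g 2 volume := by
  rw [hf.eLpNorm_eq_integral_rpow_norm two_ne_zero ENNReal.ofNat_ne_top,
    hg.eLpNorm_eq_integral_rpow_norm two_ne_zero ENNReal.ofNat_ne_top]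
  simp only [ENNReal.toReal_ofNat, Real.rpow_two, Real.norm_eq_abs, sq_abs]
  exact ENNReal.ofReal_le_ofReal
    (Real.rpow_le_rpow (integral_nonneg fun _ => sq_nonneg _) h (by norm_num))

/-- **Cauchy–Schwarz for mixed second derivatives**: `(∂_b∂ₐW)² ≤ ‖a‖²‖b‖² Σᵢⱼ (∂ⱼ∂ᵢW)²`
pointwise, for `W ∈ C²` (`∂ⱼ∂ₐW = ∂ₐ∂ⱼW` and `sq_fderiv_apply_le` twice). [folklore] -/
theorem sq_fderiv_fderiv_apply_le_normSq_mul_sum {W : EuclideanSpace ℝ (Fin 3) → ℝ}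
    (hW : ContDiff ℝ 2 W) (x a b : EuclideanSpace ℝ (Fin 3)) :
    (fderiv ℝ (fun y => fderiv ℝ W y a) x b) ^ 2 ≤
      ‖a‖ ^ 2 * ‖b‖ ^ 2 * ∑ i : Fin 3, ∑ j : Fin 3,
        (fderiv ℝ (fun y => fderiv ℝ W y (EuclideanSpace.single i 1)) x
          (EuclideanSpace.single j 1)) ^ 2 := by
  have h1 := sq_fderiv_apply_le (fun y => fderiv ℝ W y a) x b
  have hc : ∀ j : Fin 3, fderiv ℝ (fun y => fderiv ℝ W y a) x (EuclideanSpace.single j 1) =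
      fderiv ℝ (fun y => fderiv ℝ W y (EuclideanSpace.single j 1)) x a := fun j =>
    fderiv_fderiv_apply_comm_vec_scalar hW x a (EuclideanSpace.single j 1)
  rw [hc 0, hc 1, hc 2] at h1
  have h2 : ∀ j : Fin 3, (fderiv ℝ (fun y => fderiv ℝ W y (EuclideanSpace.single j 1)) x a) ^ 2 ≤
      ‖a‖ ^ 2 * (fderiv ℝ (fun y => fderiv ℝ W y (EuclideanSpace.single j 1)) x
          (EuclideanSpace.single 0 1) ^ 2 +
        fderiv ℝ (fun y => fderiv ℝ W y (EuclideanSpace.single j 1)) x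
          (EuclideanSpace.single 1 1) ^ 2 +
        fderiv ℝ (fun y => fderiv ℝ W y (EuclideanSpace.single j 1)) x
          (EuclideanSpace.single 2 1) ^ 2) := fun j =>
    sq_fderiv_apply_le (fun y => fderiv ℝ W y (EuclideanSpace.single j 1)) x a
  refine h1.trans ?_
  rw [mul_comm (‖a‖ ^ 2), mul_assoc]
  refine mul_le_mul_of_nonneg_left ?_ (sq_nonneg _)
  simp only [Fin.sum_univ_three, mul_add]
  linarith [h2 0, h2 1, h2 2]

end LTwo

/-! ### The global bounds for compactly supported fields -/

section Global

variable {u : EuclideanSpace ℝ (Fin 3) → EuclideanSpace ℝ (Fin 3)}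

/-- **`∫ |∇(u_r/r)|² ≤ ∫ (ω_θ/r)²`** (Chen–Fang–Zhang 2017, Lemma 2.3 / Miao–Zheng 2013, Prop. 2.5 /
Lei–Zhang 2017, Lemma 2.1, first estimate, constant `1`) for every axisymmetric divergence-free
`u ∈ C⁴(ℝ³; ℝ³)` with compact support: the tree's `IsAxisymmetric.integral_gradSq_radVelQuot_le`
with its ten `L²` provisos discharged by compact support. [cite: Seregin2022LocalAxisym, §2 Lemma 2.1 (arXiv:2201.00153 p. 5, the global bounds for W)] [cite: LeiZhang2017, Lemma 2.1 (first estimate)] -/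
theorem integral_gradSq_radVelQuot_le_of_hasCompactSupport (hu : ContDiff ℝ 4 u)
    (hc : HasCompactSupport u) (hax : IsAxisymmetric u) (hdiv : VectorCalculus.IsDivFree u) :
    ∫ x, (fderiv ℝ (radVelQuot u) x (EuclideanSpace.single 0 1) ^ 2 +
        fderiv ℝ (radVelQuot u) x (EuclideanSpace.single 1 1) ^ 2 +
        fderiv ℝ (radVelQuot u) x (EuclideanSpace.single 2 1) ^ 2) ≤
      ∫ x, angVortQuot u x ^ 2 := by
  have hu2 : ContDiff ℝ 2 u := hu.of_le (by norm_num)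
  have hu3 : ContDiff ℝ 3 u := hu.of_le (by norm_num)
  have hρ2 : ContDiff ℝ 2 (radVelQuot u) := contDiff_radVelQuot (n := 2) (by exact_mod_cast hu)
  have hρ1 : ContDiff ℝ 1 (radVelQuot u) := hρ2.of_le (by norm_num)
  have hρax : IsAxisymmetricScalar (radVelQuot u) := hax.isAxisymmetricScalar_radVelQuot hu2
  have hρc : HasCompactSupport (radVelQuot u) := hasCompactSupport_radVelQuot hu2 hax hc
  have hω1 : ContDiff ℝ 1 (angVortQuot u) := contDiff_angVortQuot (n := 1) (by exact_mod_cast hu)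
  have hωc : HasCompactSupport (angVortQuot u) := hasCompactSupport_angVortQuot hu3 hax hc
  have hρ : MemLp (radVelQuot u) 2 volume := hρ2.continuous.memLp_of_hasCompactSupport hρc
  have hq : MemLp (radDerivQuot (radVelQuot u)) 2 volume :=
    (continuous_radDerivQuot hρ2).memLp_of_hasCompactSupport
      (hasCompactSupport_radDerivQuot hρ2 hρax hρc)
  have hG := memLp_fderiv_apply_of_hasCompactSupport hρ1 hρc
  have hGG := memLp_fderiv_fderiv_apply_of_hasCompactSupport hρ2 hρc
  have hω : MemLp (angVortQuot u) 2 volume := hω1.continuous.memLp_of_hasCompactSupport hωc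
  have hωz := memLp_fderiv_apply_of_hasCompactSupport hω1 hωc (EuclideanSpace.single 2 1)
  exact hax.integral_gradSq_radVelQuot_le hu hdiv hρ hq (hG _) (hG _) (hG _) (hGG _ _) (hGG _ _)
    (hGG _ _) hω hωz

/-- **`‖∂ₐ(u_r/r)‖_{L²(ℝ³)} ≤ ‖ω_θ/r‖_{L²(ℝ³)}`** for every direction `a` with `‖a‖ ≤ 1` and every
axisymmetric divergence-free `u ∈ C⁴(ℝ³; ℝ³)` with compact support — the first global bound of
Chen–Fang–Zhang 2017, Lemma 2.3 (`‖∇W‖₂ ≤ c‖Γ‖₂`, `W = u_r/r = radVelQuot u`,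
`Γ = ω_θ/r = angVortQuot u`) quoted in Seregin 2022, Lemma 2.1, with `c = 1`. Registered
sub-goal toward `stub_sereginLogSwirlOrigin`. [cite: Seregin2022LocalAxisym, §2 Lemma 2.1 (arXiv:2201.00153 p. 5, the global bounds for W)] [cite: LeiZhang2017, Lemma 2.1 (first estimate)] -/
theorem eLpNorm_fderiv_radVelQuot_le_eLpNorm_angVortQuot : ∀ u : EuclideanSpace ℝ (Fin 3) → EuclideanSpace ℝ (Fin 3), ContDiff ℝ 4 u → HasCompactSupport u → IsAxisymmetric u → VectorCalculus.IsDivFree u → ∀ a : EuclideanSpace ℝ (Fin 3), ‖a‖ ≤ 1 → eLpNorm (fun x => fderiv ℝ (radVelQuot u) x a) 2 volume ≤ eLpNorm (angVortQuot u) 2 volume := by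
  intro u hu hc hax hdiv a ha
  have hu2 : ContDiff ℝ 2 u := hu.of_le (by norm_num)
  have hu3 : ContDiff ℝ 3 u := hu.of_le (by norm_num)
  have hρ2 : ContDiff ℝ 2 (radVelQuot u) := contDiff_radVelQuot (n := 2) (by exact_mod_cast hu)
  have hρ1 : ContDiff ℝ 1 (radVelQuot u) := hρ2.of_le (by norm_num)
  have hρc : HasCompactSupport (radVelQuot u) := hasCompactSupport_radVelQuot hu2 hax hc
  have hω1 : ContDiff ℝ 1 (angVortQuot u) := contDiff_angVortQuot (n := 1) (by exact_mod_cast hu)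
  have hωc : HasCompactSupport (angVortQuot u) := hasCompactSupport_angVortQuot hu3 hax hc
  have hG := memLp_fderiv_apply_of_hasCompactSupport hρ1 hρc
  have hω : MemLp (angVortQuot u) 2 volume := hω1.continuous.memLp_of_hasCompactSupport hωc
  refine eLpNorm_two_le_of_integral_sq_le' (hG a) hω
    (le_trans ?_ (integral_gradSq_radVelQuot_le_of_hasCompactSupport hu hc hax hdiv))
  refine integral_mono (hG a).integrable_sq
    (((hG _).integrable_sq.add (hG _).integrable_sq).add (hG _).integrable_sq) fun x => ?_
  have h := sq_fderiv_apply_le (radVelQuot u) x a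
  have ha2 : ‖a‖ ^ 2 ≤ 1 := pow_le_one₀ (norm_nonneg a) ha
  have hnn : 0 ≤ fderiv ℝ (radVelQuot u) x (EuclideanSpace.single 0 1) ^ 2 +
      fderiv ℝ (radVelQuot u) x (EuclideanSpace.single 1 1) ^ 2 +
      fderiv ℝ (radVelQuot u) x (EuclideanSpace.single 2 1) ^ 2 := by positivity
  nlinarith

/-- **`∫ |∇²(u_r/r)|² ≤ ∫ (∂₃(ω_θ/r))²`** (Chen–Fang–Zhang 2017, Lemma 2.3 / Miao–Zheng 2013,
Prop. 2.5 / Lei–Zhang 2017, Lemma 2.1, second estimate, full Cartesian Hessian, constant `1`) for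
every axisymmetric divergence-free `u ∈ C⁵(ℝ³; ℝ³)` with compact support:
`∫ Σᵢⱼ(∂ⱼ∂ᵢρ)² = ∫ (Δρ)²` (Hessian–Laplacian identity) `≤ ∫ (∂₃Γ)²`
(`IsAxisymmetric.integral_laplacian_radVelQuot_sq_le'`), all `L²` provisos by compact support.
[cite: Seregin2022LocalAxisym, §2 Lemma 2.1 (arXiv:2201.00153 p. 5, the global bounds for W)] [cite: LeiZhang2017, Lemma 2.1 (second estimate)] -/
theorem integral_hessianSq_radVelQuot_le_of_hasCompactSupport (hu : ContDiff ℝ 5 u)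
    (hc : HasCompactSupport u) (hax : IsAxisymmetric u) (hdiv : VectorCalculus.IsDivFree u) :
    ∫ x, ∑ i : Fin 3, ∑ j : Fin 3,
        (fderiv ℝ (fun y => fderiv ℝ (radVelQuot u) y (EuclideanSpace.single i 1)) x
          (EuclideanSpace.single j 1)) ^ 2 ≤
      ∫ x, fderiv ℝ (angVortQuot u) x (EuclideanSpace.single 2 1) ^ 2 := by
  have hu2 : ContDiff ℝ 2 u := hu.of_le (by norm_num)
  have hρ3 : ContDiff ℝ 3 (radVelQuot u) := contDiff_radVelQuot (n := 3) (by exact_mod_cast hu)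
  have hρ2 : ContDiff ℝ 2 (radVelQuot u) := hρ3.of_le (by norm_num)
  have hρ1 : ContDiff ℝ 1 (radVelQuot u) := hρ3.of_le (by norm_num)
  have hρax : IsAxisymmetricScalar (radVelQuot u) := hax.isAxisymmetricScalar_radVelQuot hu2
  have hρc : HasCompactSupport (radVelQuot u) := hasCompactSupport_radVelQuot hu2 hax hc
  have hq : MemLp (radDerivQuot (radVelQuot u)) 2 volume :=
    (continuous_radDerivQuot hρ2).memLp_of_hasCompactSupport
      (hasCompactSupport_radDerivQuot hρ2 hρax hρc)
  have hG := memLp_fderiv_apply_of_hasCompactSupport hρ1 hρc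
  have hGG := memLp_fderiv_fderiv_apply_of_hasCompactSupport hρ2 hρc
  -- the partial derivatives `∂ᵢρ ∈ C²` are compactly supported
  have hGi2 : ∀ v : EuclideanSpace ℝ (Fin 3), ContDiff ℝ 2 fun y => fderiv ℝ (radVelQuot u) y v :=
    fun v => contDiff_fderiv_apply_const_succ (n := 2) (by exact_mod_cast hρ3) v
  have hGic : ∀ v : EuclideanSpace ℝ (Fin 3),
      HasCompactSupport fun y => fderiv ℝ (radVelQuot u) y v := fun v => hρc.fderiv_apply ℝ v
  have hGGG : ∀ i j : Fin 3, MemLp (fun x => fderiv ℝ (fun y => fderiv ℝ (fun z =>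
      fderiv ℝ (radVelQuot u) z (EuclideanSpace.single i 1)) y (EuclideanSpace.single j 1)) x
      (EuclideanSpace.single j 1)) 2 volume := fun i j =>
    memLp_fderiv_fderiv_apply_of_hasCompactSupport (hGi2 _) (hGic _) _ _
  have hqH : MemLp (radDerivQuot fun y => fderiv ℝ (radVelQuot u) y (EuclideanSpace.single 2 1))
      2 volume :=
    (continuous_radDerivQuot (hGi2 _)).memLp_of_hasCompactSupport
      (hasCompactSupport_radDerivQuot (hGi2 _)
        (hρax.fderiv_apply_single_two (hρ2.differentiable two_ne_zero)) (hGic _))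
  rw [integral_sum_sq_fderiv_fderiv_eq_integral_laplacian_sq_of_memLp hρ3 (fun i => hG _)
    (fun i j => hGG _ _) hGGG]
  exact hax.integral_laplacian_radVelQuot_sq_le' hu hdiv hq (fun i => hG _) (fun i => hGG _ _) hqH

/-- **`‖∂_b∂ₐ(u_r/r)‖_{L²(ℝ³)} ≤ ‖∂₃(ω_θ/r)‖_{L²(ℝ³)}`** for all directions `a, b` with
`‖a‖, ‖b‖ ≤ 1` and every axisymmetric divergence-free `u ∈ C⁵(ℝ³; ℝ³)` with compact support — the
second global bound of Chen–Fang–Zhang 2017, Lemma 2.3 (`‖∇̄²W‖₂ ≤ c‖Γ,₃‖₂`, here for the full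
Cartesian Hessian of `W = u_r/r = radVelQuot u`, `Γ = ω_θ/r = angVortQuot u`) quoted in
Seregin 2022, Lemma 2.1, with `c = 1`. Registered sub-goal toward `stub_sereginLogSwirlOrigin`.
[cite: Seregin2022LocalAxisym, §2 Lemma 2.1 (arXiv:2201.00153 p. 5, the global bounds for W)] [cite: LeiZhang2017, Lemma 2.1 (second estimate)] -/
theorem eLpNorm_fderiv_fderiv_radVelQuot_le_eLpNorm_fderiv_angVortQuot : ∀ u : EuclideanSpace ℝ (Fin 3) → EuclideanSpace ℝ (Fin 3), ContDiff ℝ 5 u → HasCompactSupport u → IsAxisymmetric u → VectorCalculus.IsDivFree u → ∀ a b : EuclideanSpace ℝ (Fin 3), ‖a‖ ≤ 1 → ‖b‖ ≤ 1 → eLpNorm (fun x => fderiv ℝ (fun y => fderiv ℝ (radVelQuot u) y a) x b) 2 volume ≤ eLpNorm (fun x => fderiv ℝ (angVortQuot u) x (EuclideanSpace.single 2 1)) 2 volume := by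
  intro u hu hc hax hdiv a b ha hb
  have hu2 : ContDiff ℝ 2 u := hu.of_le (by norm_num)
  have hu4 : ContDiff ℝ 4 u := hu.of_le (by norm_num)
  have hρ3 : ContDiff ℝ 3 (radVelQuot u) := contDiff_radVelQuot (n := 3) (by exact_mod_cast hu)
  have hρ2 : ContDiff ℝ 2 (radVelQuot u) := hρ3.of_le (by norm_num)
  have hρc : HasCompactSupport (radVelQuot u) := hasCompactSupport_radVelQuot hu2 hax hc
  have hω2 : ContDiff ℝ 2 (angVortQuot u) := contDiff_angVortQuot (n := 2) (by exact_mod_cast hu)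
  have hωc : HasCompactSupport (angVortQuot u) := hasCompactSupport_angVortQuot (hu.of_le (by norm_num)) hax hc
  have hGG := memLp_fderiv_fderiv_apply_of_hasCompactSupport hρ2 hρc
  have hωz := memLp_fderiv_apply_of_hasCompactSupport (hω2.of_le (by norm_num)) hωc
    (EuclideanSpace.single 2 1)
  have hH : Integrable (fun x => ∑ i : Fin 3, ∑ j : Fin 3,
      (fderiv ℝ (fun y => fderiv ℝ (radVelQuot u) y (EuclideanSpace.single i 1)) x
        (EuclideanSpace.single j 1)) ^ 2) volume :=
    integrable_finsetSum _ fun i _ => integrable_finsetSum _ fun j _ => (hGG _ _).integrable_sq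
  refine eLpNorm_two_le_of_integral_sq_le' (hGG a b) hωz
    (le_trans ?_ (integral_hessianSq_radVelQuot_le_of_hasCompactSupport hu hc hax hdiv))
  refine integral_mono (hGG a b).integrable_sq hH fun x => ?_
  have h := sq_fderiv_fderiv_apply_le_normSq_mul_sum hρ2 x a b
  have hab : ‖a‖ ^ 2 * ‖b‖ ^ 2 ≤ 1 :=
    mul_le_one₀ (pow_le_one₀ (norm_nonneg a) ha) (sq_nonneg _) (pow_le_one₀ (norm_nonneg b) hb)
  have hnn : 0 ≤ ∑ i : Fin 3, ∑ j : Fin 3,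
      (fderiv ℝ (fun y => fderiv ℝ (radVelQuot u) y (EuclideanSpace.single i 1)) x
        (EuclideanSpace.single j 1)) ^ 2 :=
    Finset.sum_nonneg fun i _ => Finset.sum_nonneg fun j _ => sq_nonneg _
  nlinarith

end Global

end Summit.NavierStokesRegularity.NavierStokesRegularity.Theorems.AxisymmetricKatoGlobal.EulerScaling

end
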